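import Mathlib
import HarnessLib
import Summits.HubbardSuperconductivity.HubbardSuperconductivity.Theorems.KLProgrammeKLRegimeWickCrossContractionSector
import Summits.HubbardSuperconductivity.HubbardSuperconductivity.Theorems.KLProgrammeKLRegimeFatOverlapCount
import Summits.HubbardSuperconductivity.HubbardSuperconductivity.Theorems.KLProgrammeKLRegimeSectorSliceGramRegime

/-!
# Route `KLProgramme` — ENGINE child stmt-HubbardSuperconductivity-20236 `KLRegimeEngineV16`, `stub_engine_step_values` (E2-v10, the E.5 / `CR`
# classes) and `stub_engine_step_norms`: the `k + 1`-line two-vertex term on FAT-SECTORISED fields — p5's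
# `sum_norm_kernel_crossContract_pullback_le` keyed on `Ft = bgmFatMultiplier … (m+1)` (`ρ₀ = 9`), and the ENGINE instance with the
# entry constants `δ` DISCHARGED by the regime-keyed `κ²` of …SectorSliceGramRegime

Cell gate-hubbard-kl, seat hubbard-kl-k3c2-p3 (g4, row «sector-counting import (DR2000 L11/L12) for the leg-dress bar»).  By the transport
`dblFold_crossContract_map` / `map_sectorSub_sectorPreimage` (p5 g4) the physical two-copy term of the step is the push-forward under `S(Ft)` of the
sector-field term whose lines are `S(Ft)ᵀ·C·S(Ft)` with `Ft` the FAT partner (`Ft·F = F`) of the thin family `F` sectorising the vertices; by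
SECTOR-RADIAL-ALIGNMENT (evidence #13 on 20236) `F = klAnisoFamily k`, `Ft = bgmFatMultiplier … k` with `k ≤ n − 1` for scale-`n` vertices and slice
lines of index `≥ k + 2`.  This file is the fat-keyed reading of p5's …WickCrossContractionSector §Aniso plus the engine instance:

* §1 `sum_norm_kernel_crossContract_bgmFat_le` / `…_of_eq_one`, `sum_norm_kernel_crossLaplacian_pow_bgmFat_le` / `…_of_eq_one` — any symbols,
  fat family of index `m+1`, `ρ₀ = 9` (`card_overlap_bgmFat_le_nine`): `… ≤ ((k+1+m₀)!(k+1+m₁)!/m!)·(α·∏_i(36·δ_i)·Na·Nb)`;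
* §2 **`sum_norm_kernel_crossLaplacian_pow_klSliceCov_bgmFat_klEng`** / **`…_of_eq_one`** — under EXACTLY the gen-6 stub binders, fat family of
  index `n` (`1 ≤ n ≤ nScales β + 1`), ALL `k+1` lines the engine slice `g_{n′} = klSliceCov … n′` with `n ≤ n′`: `∃ Cκ > 0` (the constant of
  `gram_entry_klSliceCov_bgmFat_klEng`) with
  `Σ_{Z : Z p = z} ‖kernel ((Δ_×(S(Ft_n)ᵀ g_{n′} S(Ft_n)))^{k+1} (a⁰ b¹)) m (Z,s)‖ ≤ ((k+1+m₀)!(k+1+m₁)!/m!)·(α·(36·Cκ·(Λ_n/Λ_{n′})·e₀·8^{-n})^k·Na·Nb)`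
  — the ENTRY constants `δ` are no longer hypotheses; what the E2/E1 prover still supplies is `α` (row/column sums of line `0`, the shifted-slice
  closed form recorded as missing in SECTOR-RADIAL-ALIGNMENT §3) and the vertex norms `Na`, `Nb` (its (E1-v4)/(E1-F) invariants).

Pure bookkeeping; no definitions, no named facts.  References (locators only): Feldman–Knörrer–Trubowitz, Rev. Math. Phys. 15 (2003) Prop. XII;
Benfatto–Giuliani–Mastropietro, Ann. Henri Poincaré 7 (2006) §2.7 (2.66), (2.71a), §2.8 (2.80)–(2.83).
-/

noncomputable section

namespace Summit.HubbardSuperconductivity.HubbardSuperconductivity.Theorems.KLRegimeWick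

set_option linter.dupNamespace false -- summit = problem name (single-conjunct summit), D-0017

open Literature.MathematicalPhysics.QuantumLattice Literature.Probability.LatticeModels GrassmannAlgebra Finset Matrix
open Summit.HubbardSuperconductivity.HubbardSuperconductivity.Theorems.KLProgrammeLegKernels
open Summit.HubbardSuperconductivity.HubbardSuperconductivity.Theorems.KLRegimeSplit
open Summit.HubbardSuperconductivity.HubbardSuperconductivity.Theorems.TorusFourierL2
open scoped ComplexConjugate

/-! ## §1 The fat-keyed instances of p5's pulled-back cross-contraction bounds (`ρ₀ = 9`) -/

section Fat

variable {L M : ℕ} [NeZero L] (e₀ β μ : ℝ) (K : TrigPolyC4v) (m : ℕ)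

/-- **The `k + 1`-line two-vertex term on FAT sector fields of index `m+1`, pinned at a free leg of `a`**: symbols `p_0, …, p_k`
(line `0`: row/column sums `≤ α`; lines `i ≥ 1`: entries `≤ δ_i`) ⇒ `… ≤ ((k+1+m₀)!(k+1+m₁)!/m!) · (α · ∏_i (δ_i · 36) · Na · Nb)`.
[cite: BenfattoGiulianiMastropietro2006, §2.7 (2.71a)] -/
theorem sum_norm_kernel_crossContract_bgmFat_le {k n m₀ m₁ : ℕ} (sym : Fin (k + 1) → FreqMomentum L M × Fin 2 → ℂ)
    (a b : GrassmannAlgebra ℂ (SpaceTimeIdx L M × SectorLeg (sectorCount (m + 1)))) (s : Fin n → Fin 2)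
    (hm₀ : (univ.filter fun i => s i = 0).card = m₀) (hm₁ : (univ.filter fun i => s i = 1).card = m₁) (p : Fin n) (hp : s p = 0)
    (z : SpaceTimeIdx L M × SectorLeg (sectorCount (m + 1))) {α : ℝ}
    (hrow : ∀ X, ∑ Y, ‖((sectorSubMatrix L M β (bgmFatMultiplier L M e₀ β (nambuXiCT L μ K) (m + 1))).transpose *
      normalCovariance L M (sym 0) * sectorSubMatrix L M β (bgmFatMultiplier L M e₀ β (nambuXiCT L μ K) (m + 1))) X Y‖ ≤ α)
    (hcol : ∀ Y, ∑ X, ‖((sectorSubMatrix L M β (bgmFatMultiplier L M e₀ β (nambuXiCT L μ K) (m + 1))).transpose *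
      normalCovariance L M (sym 0) * sectorSubMatrix L M β (bgmFatMultiplier L M e₀ β (nambuXiCT L μ K) (m + 1))) X Y‖ ≤ α)
    (δ : Fin k → ℝ) (hδ : ∀ i, 0 ≤ δ i)
    (hent : ∀ (i : Fin k) X Y, ‖((sectorSubMatrix L M β (bgmFatMultiplier L M e₀ β (nambuXiCT L μ K) (m + 1))).transpose *
      normalCovariance L M (sym i.succ) * sectorSubMatrix L M β (bgmFatMultiplier L M e₀ β (nambuXiCT L μ K) (m + 1))) X Y‖ ≤ δ i)
    {Na Nb : ℝ} (hNb0 : 0 ≤ Nb)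
    (hNa : ∀ p₀ : Fin m₀, ∑ X : Fin (k + 1) → SpaceTimeIdx L M × SectorLeg (sectorCount (m + 1)),
      ∑ X₀ ∈ univ.filter (fun X₀ : Fin m₀ → SpaceTimeIdx L M × SectorLeg (sectorCount (m + 1)) => X₀ p₀ = z),
        ‖kernel ℂ a (k + 1 + m₀) (Fin.append X X₀)‖ ≤ Na)
    (hNb : ∀ (Y₀ : SpaceTimeIdx L M × SectorLeg (sectorCount (m + 1))) (τ : Fin k → SectorLeg (sectorCount (m + 1))),
      ∑ y : Fin k → SpaceTimeIdx L M, ∑ Y₁ : Fin m₁ → SpaceTimeIdx L M × SectorLeg (sectorCount (m + 1)),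
        ‖kernel ℂ b (k + 1 + m₁) (Fin.append
          (Fin.cons Y₀ (fun i => (y i, τ i)) : Fin (k + 1) → SpaceTimeIdx L M × SectorLeg (sectorCount (m + 1))) Y₁)‖ ≤ Nb) :
    ∑ Z ∈ univ.filter (fun Z : Fin n → SpaceTimeIdx L M × SectorLeg (sectorCount (m + 1)) => Z p = z),
        ‖kernel ℂ (((List.ofFn fun i => grassmannLaplacian ℂ (crossCov ℂ
            ((sectorSubMatrix L M β (bgmFatMultiplier L M e₀ β (nambuXiCT L μ K) (m + 1))).transpose * normalCovariance L M (sym i) *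
              sectorSubMatrix L M β (bgmFatMultiplier L M e₀ β (nambuXiCT L μ K) (m + 1))))).reverse).prod
          (dblCopy ℂ 0 a * dblCopy ℂ 1 b)) n (fun i => (Z i, s i))‖ ≤
      (((k + 1 + m₀).factorial * (k + 1 + m₁).factorial : ℝ) / n.factorial) * (α * (∏ i, δ i * 36) * Na * Nb) := by
  have h := sum_norm_kernel_crossContract_pullback_le β (bgmFatMultiplier L M e₀ β (nambuXiCT L μ K) (m + 1))
    (card_overlap_bgmFat_le_nine (μ := μ) (e₀ := e₀) (β := β) (K := K) m) sym a b s hm₀ hm₁ p hp z hrow hcol δ hδ hent hNb0 hNa hNb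
  have e : (∏ i, δ i * ((4 * 9 : ℕ) : ℝ)) = ∏ i, δ i * 36 := prod_congr rfl fun i _ => by push_cast; norm_num
  rwa [e] at h

/-- **The same, pinned at a free leg of `b`.** [cite: BenfattoGiulianiMastropietro2006, §2.7 (2.71a)] -/
theorem sum_norm_kernel_crossContract_bgmFat_le_of_eq_one {k n m₀ m₁ : ℕ} (sym : Fin (k + 1) → FreqMomentum L M × Fin 2 → ℂ)
    (a b : GrassmannAlgebra ℂ (SpaceTimeIdx L M × SectorLeg (sectorCount (m + 1)))) (s : Fin n → Fin 2)
    (hm₀ : (univ.filter fun i => s i = 0).card = m₀) (hm₁ : (univ.filter fun i => s i = 1).card = m₁) (p : Fin n) (hp : s p = 1)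
    (z : SpaceTimeIdx L M × SectorLeg (sectorCount (m + 1))) {α : ℝ}
    (hrow : ∀ X, ∑ Y, ‖((sectorSubMatrix L M β (bgmFatMultiplier L M e₀ β (nambuXiCT L μ K) (m + 1))).transpose *
      normalCovariance L M (sym 0) * sectorSubMatrix L M β (bgmFatMultiplier L M e₀ β (nambuXiCT L μ K) (m + 1))) X Y‖ ≤ α)
    (hcol : ∀ Y, ∑ X, ‖((sectorSubMatrix L M β (bgmFatMultiplier L M e₀ β (nambuXiCT L μ K) (m + 1))).transpose *
      normalCovariance L M (sym 0) * sectorSubMatrix L M β (bgmFatMultiplier L M e₀ β (nambuXiCT L μ K) (m + 1))) X Y‖ ≤ α)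
    (δ : Fin k → ℝ) (hδ : ∀ i, 0 ≤ δ i)
    (hent : ∀ (i : Fin k) X Y, ‖((sectorSubMatrix L M β (bgmFatMultiplier L M e₀ β (nambuXiCT L μ K) (m + 1))).transpose *
      normalCovariance L M (sym i.succ) * sectorSubMatrix L M β (bgmFatMultiplier L M e₀ β (nambuXiCT L μ K) (m + 1))) X Y‖ ≤ δ i)
    {Na Nb : ℝ} (hNa0 : 0 ≤ Na)
    (hNa : ∀ (X₀ : SpaceTimeIdx L M × SectorLeg (sectorCount (m + 1))) (σ : Fin k → SectorLeg (sectorCount (m + 1))),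
      ∑ x : Fin k → SpaceTimeIdx L M, ∑ Z₀ : Fin m₀ → SpaceTimeIdx L M × SectorLeg (sectorCount (m + 1)),
        ‖kernel ℂ a (k + 1 + m₀) (Fin.append
          (Fin.cons X₀ (fun i => (x i, σ i)) : Fin (k + 1) → SpaceTimeIdx L M × SectorLeg (sectorCount (m + 1))) Z₀)‖ ≤ Na)
    (hNb : ∀ p₁ : Fin m₁, ∑ Y : Fin (k + 1) → SpaceTimeIdx L M × SectorLeg (sectorCount (m + 1)),
      ∑ Y₁ ∈ univ.filter (fun Y₁ : Fin m₁ → SpaceTimeIdx L M × SectorLeg (sectorCount (m + 1)) => Y₁ p₁ = z),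
        ‖kernel ℂ b (k + 1 + m₁) (Fin.append Y Y₁)‖ ≤ Nb) :
    ∑ Z ∈ univ.filter (fun Z : Fin n → SpaceTimeIdx L M × SectorLeg (sectorCount (m + 1)) => Z p = z),
        ‖kernel ℂ (((List.ofFn fun i => grassmannLaplacian ℂ (crossCov ℂ
            ((sectorSubMatrix L M β (bgmFatMultiplier L M e₀ β (nambuXiCT L μ K) (m + 1))).transpose * normalCovariance L M (sym i) *
              sectorSubMatrix L M β (bgmFatMultiplier L M e₀ β (nambuXiCT L μ K) (m + 1))))).reverse).prod
          (dblCopy ℂ 0 a * dblCopy ℂ 1 b)) n (fun i => (Z i, s i))‖ ≤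
      (((k + 1 + m₀).factorial * (k + 1 + m₁).factorial : ℝ) / n.factorial) * (α * (∏ i, δ i * 36) * Na * Nb) := by
  have h := sum_norm_kernel_crossContract_pullback_le_of_eq_one β (bgmFatMultiplier L M e₀ β (nambuXiCT L μ K) (m + 1))
    (card_overlap_bgmFat_le_nine (μ := μ) (e₀ := e₀) (β := β) (K := K) m) sym a b s hm₀ hm₁ p hp z hrow hcol δ hδ hent hNa0 hNa hNb
  have e : (∏ i, δ i * ((4 * 9 : ℕ) : ℝ)) = ∏ i, δ i * 36 := prod_congr rfl fun i _ => by push_cast; norm_num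
  rwa [e] at h

/-- **One symbol on all lines, fat family of index `m+1`, pinned at a free leg of `a`**:
`… ≤ ((k+1+m₀)!(k+1+m₁)!/m!) · (α · (36δ)^k · Na · Nb)`. [cite: BenfattoGiulianiMastropietro2006, §2.7 (2.71a)] -/
theorem sum_norm_kernel_crossLaplacian_pow_bgmFat_le {k n m₀ m₁ : ℕ} (sym : FreqMomentum L M × Fin 2 → ℂ)
    (a b : GrassmannAlgebra ℂ (SpaceTimeIdx L M × SectorLeg (sectorCount (m + 1)))) (s : Fin n → Fin 2)
    (hm₀ : (univ.filter fun i => s i = 0).card = m₀) (hm₁ : (univ.filter fun i => s i = 1).card = m₁) (p : Fin n) (hp : s p = 0)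
    (z : SpaceTimeIdx L M × SectorLeg (sectorCount (m + 1))) {α : ℝ}
    (hrow : ∀ X, ∑ Y, ‖((sectorSubMatrix L M β (bgmFatMultiplier L M e₀ β (nambuXiCT L μ K) (m + 1))).transpose *
      normalCovariance L M sym * sectorSubMatrix L M β (bgmFatMultiplier L M e₀ β (nambuXiCT L μ K) (m + 1))) X Y‖ ≤ α)
    (hcol : ∀ Y, ∑ X, ‖((sectorSubMatrix L M β (bgmFatMultiplier L M e₀ β (nambuXiCT L μ K) (m + 1))).transpose *
      normalCovariance L M sym * sectorSubMatrix L M β (bgmFatMultiplier L M e₀ β (nambuXiCT L μ K) (m + 1))) X Y‖ ≤ α)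
    {δ : ℝ} (hδ : 0 ≤ δ)
    (hent : ∀ X Y, ‖((sectorSubMatrix L M β (bgmFatMultiplier L M e₀ β (nambuXiCT L μ K) (m + 1))).transpose *
      normalCovariance L M sym * sectorSubMatrix L M β (bgmFatMultiplier L M e₀ β (nambuXiCT L μ K) (m + 1))) X Y‖ ≤ δ)
    {Na Nb : ℝ} (hNb0 : 0 ≤ Nb)
    (hNa : ∀ p₀ : Fin m₀, ∑ X : Fin (k + 1) → SpaceTimeIdx L M × SectorLeg (sectorCount (m + 1)),
      ∑ X₀ ∈ univ.filter (fun X₀ : Fin m₀ → SpaceTimeIdx L M × SectorLeg (sectorCount (m + 1)) => X₀ p₀ = z),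
        ‖kernel ℂ a (k + 1 + m₀) (Fin.append X X₀)‖ ≤ Na)
    (hNb : ∀ (Y₀ : SpaceTimeIdx L M × SectorLeg (sectorCount (m + 1))) (τ : Fin k → SectorLeg (sectorCount (m + 1))),
      ∑ y : Fin k → SpaceTimeIdx L M, ∑ Y₁ : Fin m₁ → SpaceTimeIdx L M × SectorLeg (sectorCount (m + 1)),
        ‖kernel ℂ b (k + 1 + m₁) (Fin.append
          (Fin.cons Y₀ (fun i => (y i, τ i)) : Fin (k + 1) → SpaceTimeIdx L M × SectorLeg (sectorCount (m + 1))) Y₁)‖ ≤ Nb) :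
    ∑ Z ∈ univ.filter (fun Z : Fin n → SpaceTimeIdx L M × SectorLeg (sectorCount (m + 1)) => Z p = z),
        ‖kernel ℂ (((grassmannLaplacian ℂ (crossCov ℂ
            ((sectorSubMatrix L M β (bgmFatMultiplier L M e₀ β (nambuXiCT L μ K) (m + 1))).transpose * normalCovariance L M sym *
              sectorSubMatrix L M β (bgmFatMultiplier L M e₀ β (nambuXiCT L μ K) (m + 1))))) ^ (k + 1))
          (dblCopy ℂ 0 a * dblCopy ℂ 1 b)) n (fun i => (Z i, s i))‖ ≤
      (((k + 1 + m₀).factorial * (k + 1 + m₁).factorial : ℝ) / n.factorial) * (α * (36 * δ) ^ k * Na * Nb) := by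
  have h := sum_norm_kernel_crossLaplacian_pow_pullback_le β (bgmFatMultiplier L M e₀ β (nambuXiCT L μ K) (m + 1))
    (card_overlap_bgmFat_le_nine (μ := μ) (e₀ := e₀) (β := β) (K := K) m) sym a b s hm₀ hm₁ p hp z hrow hcol hδ hent hNb0 hNa hNb
  have e : δ * ((4 * 9 : ℕ) : ℝ) = 36 * δ := by push_cast; ring
  rwa [e] at h

/-- **One symbol on all lines, fat family of index `m+1`, pinned at a free leg of `b`.** [cite: BenfattoGiulianiMastropietro2006, §2.7 (2.71a)] -/
theorem sum_norm_kernel_crossLaplacian_pow_bgmFat_le_of_eq_one {k n m₀ m₁ : ℕ} (sym : FreqMomentum L M × Fin 2 → ℂ)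
    (a b : GrassmannAlgebra ℂ (SpaceTimeIdx L M × SectorLeg (sectorCount (m + 1)))) (s : Fin n → Fin 2)
    (hm₀ : (univ.filter fun i => s i = 0).card = m₀) (hm₁ : (univ.filter fun i => s i = 1).card = m₁) (p : Fin n) (hp : s p = 1)
    (z : SpaceTimeIdx L M × SectorLeg (sectorCount (m + 1))) {α : ℝ}
    (hrow : ∀ X, ∑ Y, ‖((sectorSubMatrix L M β (bgmFatMultiplier L M e₀ β (nambuXiCT L μ K) (m + 1))).transpose *
      normalCovariance L M sym * sectorSubMatrix L M β (bgmFatMultiplier L M e₀ β (nambuXiCT L μ K) (m + 1))) X Y‖ ≤ α)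
    (hcol : ∀ Y, ∑ X, ‖((sectorSubMatrix L M β (bgmFatMultiplier L M e₀ β (nambuXiCT L μ K) (m + 1))).transpose *
      normalCovariance L M sym * sectorSubMatrix L M β (bgmFatMultiplier L M e₀ β (nambuXiCT L μ K) (m + 1))) X Y‖ ≤ α)
    {δ : ℝ} (hδ : 0 ≤ δ)
    (hent : ∀ X Y, ‖((sectorSubMatrix L M β (bgmFatMultiplier L M e₀ β (nambuXiCT L μ K) (m + 1))).transpose *
      normalCovariance L M sym * sectorSubMatrix L M β (bgmFatMultiplier L M e₀ β (nambuXiCT L μ K) (m + 1))) X Y‖ ≤ δ)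
    {Na Nb : ℝ} (hNa0 : 0 ≤ Na)
    (hNa : ∀ (X₀ : SpaceTimeIdx L M × SectorLeg (sectorCount (m + 1))) (σ : Fin k → SectorLeg (sectorCount (m + 1))),
      ∑ x : Fin k → SpaceTimeIdx L M, ∑ Z₀ : Fin m₀ → SpaceTimeIdx L M × SectorLeg (sectorCount (m + 1)),
        ‖kernel ℂ a (k + 1 + m₀) (Fin.append
          (Fin.cons X₀ (fun i => (x i, σ i)) : Fin (k + 1) → SpaceTimeIdx L M × SectorLeg (sectorCount (m + 1))) Z₀)‖ ≤ Na)
    (hNb : ∀ p₁ : Fin m₁, ∑ Y : Fin (k + 1) → SpaceTimeIdx L M × SectorLeg (sectorCount (m + 1)),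
      ∑ Y₁ ∈ univ.filter (fun Y₁ : Fin m₁ → SpaceTimeIdx L M × SectorLeg (sectorCount (m + 1)) => Y₁ p₁ = z),
        ‖kernel ℂ b (k + 1 + m₁) (Fin.append Y Y₁)‖ ≤ Nb) :
    ∑ Z ∈ univ.filter (fun Z : Fin n → SpaceTimeIdx L M × SectorLeg (sectorCount (m + 1)) => Z p = z),
        ‖kernel ℂ (((grassmannLaplacian ℂ (crossCov ℂ
            ((sectorSubMatrix L M β (bgmFatMultiplier L M e₀ β (nambuXiCT L μ K) (m + 1))).transpose * normalCovariance L M sym *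
              sectorSubMatrix L M β (bgmFatMultiplier L M e₀ β (nambuXiCT L μ K) (m + 1))))) ^ (k + 1))
          (dblCopy ℂ 0 a * dblCopy ℂ 1 b)) n (fun i => (Z i, s i))‖ ≤
      (((k + 1 + m₀).factorial * (k + 1 + m₁).factorial : ℝ) / n.factorial) * (α * (36 * δ) ^ k * Na * Nb) := by
  have h := sum_norm_kernel_crossLaplacian_pow_pullback_le_of_eq_one β (bgmFatMultiplier L M e₀ β (nambuXiCT L μ K) (m + 1))
    (card_overlap_bgmFat_le_nine (μ := μ) (e₀ := e₀) (β := β) (K := K) m) sym a b s hm₀ hm₁ p hp z hrow hcol hδ hent hNa0 hNa hNb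
  have e : δ * ((4 * 9 : ℕ) : ℝ) = 36 * δ := by push_cast; ring
  rwa [e] at h

end Fat

/-! ## §2 The engine instance: all lines the engine slice `g_{n′}`, fat family of index `n ≤ n′`, entry constants DISCHARGED -/

section Engine

/-- **The `k + 1`-line two-vertex term of the engine, pinned at a free leg of `a`** — under EXACTLY the gen-6 stub binders, for the fat family
of index `n` (`1 ≤ n ≤ nScales β + 1`) and all `k + 1` lines the slice `g_{n′} = klSliceCov L M β μ K n′`, `n ≤ n′`: there is an absolute
`Cκ > 0` (the constant of `gram_entry_klSliceCov_bgmFat_klEng`) with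
`Σ_{Z : Z p = z} ‖kernel ((Δ_×(S(Ft_n)ᵀ g_{n′} S(Ft_n)))^{k+1} (a⁰ b¹)) d (Z,s)‖ ≤ ((k+1+m₀)!(k+1+m₁)!/d!)·(α·(36·Cκ·(Λ_n/Λ_{n′})·e₀·8^{-n})^k·Na·Nb)`;
`α` (row/column sums of one line) and the vertex norms `Na`, `Nb` remain the caller's. [cite: BenfattoGiulianiMastropietro2006, §2.8 (2.80)–(2.83)] -/
theorem sum_norm_kernel_crossLaplacian_pow_klSliceCov_bgmFat_klEng :
    ∃ Cκ : ℝ, 0 < Cκ ∧ ∀ (P : SplitConsts) (R : RenConsts) (c : ℝ), P.WF → R.WF2 → 0 < c → c ≤ EngineV8.klEngC₃3 P R →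
      ∀ μ ∈ klWindowC, ∀ U : ℝ, 0 < U → U ≤ EngineV8.klEngU₀4 P R c → ∀ β : ℝ, klBetaMin ≤ β → β ≤ Real.exp (c / U ^ 2) →
      ∀ K : TrigPolyC4v, FrameOK R U (nScales β) μ K → ∀ (L M : ℕ) [NeZero L] [NeZero M],
      EngineV8.klEngL₃ β U ≤ L → EngineV8.klEngM₃ β U L ≤ M → ∀ n : ℕ, 1 ≤ n → n ≤ nScales β + 1 → ∀ n' : ℕ, n ≤ n' →
      ∀ (k d m₀ m₁ : ℕ) (a b : GrassmannAlgebra ℂ (SpaceTimeIdx L M × SectorLeg (sectorCount n))) (s : Fin d → Fin 2),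
        (univ.filter fun i => s i = 0).card = m₀ → (univ.filter fun i => s i = 1).card = m₁ → ∀ p : Fin d, s p = 0 →
        ∀ (z : SpaceTimeIdx L M × SectorLeg (sectorCount n)) (α : ℝ),
        (∀ X, ∑ Y, ‖((sectorSubMatrix L M β (bgmFatMultiplier L M klE0 β (nambuXiCT L μ K) n)).transpose *
          klSliceCov L M β μ K n' * sectorSubMatrix L M β (bgmFatMultiplier L M klE0 β (nambuXiCT L μ K) n)) X Y‖ ≤ α) →
        (∀ Y, ∑ X, ‖((sectorSubMatrix L M β (bgmFatMultiplier L M klE0 β (nambuXiCT L μ K) n)).transpose *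
          klSliceCov L M β μ K n' * sectorSubMatrix L M β (bgmFatMultiplier L M klE0 β (nambuXiCT L μ K) n)) X Y‖ ≤ α) →
        ∀ (Na Nb : ℝ), 0 ≤ Nb →
        (∀ p₀ : Fin m₀, ∑ X : Fin (k + 1) → SpaceTimeIdx L M × SectorLeg (sectorCount n),
          ∑ X₀ ∈ univ.filter (fun X₀ : Fin m₀ → SpaceTimeIdx L M × SectorLeg (sectorCount n) => X₀ p₀ = z),
            ‖kernel ℂ a (k + 1 + m₀) (Fin.append X X₀)‖ ≤ Na) →
        (∀ (Y₀ : SpaceTimeIdx L M × SectorLeg (sectorCount n)) (τ : Fin k → SectorLeg (sectorCount n)),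
          ∑ y : Fin k → SpaceTimeIdx L M, ∑ Y₁ : Fin m₁ → SpaceTimeIdx L M × SectorLeg (sectorCount n),
            ‖kernel ℂ b (k + 1 + m₁) (Fin.append
              (Fin.cons Y₀ (fun i => (y i, τ i)) : Fin (k + 1) → SpaceTimeIdx L M × SectorLeg (sectorCount n)) Y₁)‖ ≤ Nb) →
        ∑ Z ∈ univ.filter (fun Z : Fin d → SpaceTimeIdx L M × SectorLeg (sectorCount n) => Z p = z),
            ‖kernel ℂ (((grassmannLaplacian ℂ (crossCov ℂ
                ((sectorSubMatrix L M β (bgmFatMultiplier L M klE0 β (nambuXiCT L μ K) n)).transpose * klSliceCov L M β μ K n' *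
                  sectorSubMatrix L M β (bgmFatMultiplier L M klE0 β (nambuXiCT L μ K) n)))) ^ (k + 1))
              (dblCopy ℂ 0 a * dblCopy ℂ 1 b)) d (fun i => (Z i, s i))‖ ≤
          (((k + 1 + m₀).factorial * (k + 1 + m₁).factorial : ℝ) / d.factorial) *
            (α * (36 * (Cκ * (klScale klE0 n / klScale klE0 n') * (klE0 * ((8 : ℝ) ^ n)⁻¹))) ^ k * Na * Nb) := by
  obtain ⟨Cκ, hCκ, h⟩ := gram_entry_klSliceCov_bgmFat_klEng
  refine ⟨Cκ, hCκ, ?_⟩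
  intro P R c hP hR2 hc hc3 μ hμ U hU hU0 β hβmin hβc K hK L M _ _ hL3 hM3 n hn hnN n' hnn' k d m₀ m₁ a b s hm₀ hm₁ p hp z α hrow hcol
    Na Nb hNb0 hNa hNb
  have hent := (h P R c hP hR2 hc hc3 μ hμ U hU hU0 β hβmin hβc K hK L M hL3 hM3 n hn hnN n' hnn').1
  obtain ⟨m, rfl⟩ : ∃ m, n = m + 1 := ⟨n - 1, by omega⟩
  have he : (0 : ℝ) < klE0 := by norm_num [klE0]
  have hδ : 0 ≤ Cκ * (klScale klE0 (m + 1) / klScale klE0 n') * (klE0 * ((8 : ℝ) ^ (m + 1))⁻¹) := by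
    have := klth_klScale_pos (m + 1); have := klth_klScale_pos n'; positivity
  obtain ⟨sym, hS⟩ : ∃ sym : FreqMomentum L M × Fin 2 → ℂ, klSliceCov L M β μ K n' = normalCovariance L M sym :=
    ⟨_, by rw [klSliceCov, hubbardCovSliceCT_zero_seed]⟩
  rw [hS] at hrow hcol hent ⊢
  exact sum_norm_kernel_crossLaplacian_pow_bgmFat_le klE0 β μ K m sym a b s hm₀ hm₁ p hp z hrow hcol hδ hent hNb0 hNa hNb

/-- **The same, pinned at a free leg of `b`.** [cite: BenfattoGiulianiMastropietro2006, §2.8 (2.80)–(2.83)] -/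
theorem sum_norm_kernel_crossLaplacian_pow_klSliceCov_bgmFat_klEng_of_eq_one :
    ∃ Cκ : ℝ, 0 < Cκ ∧ ∀ (P : SplitConsts) (R : RenConsts) (c : ℝ), P.WF → R.WF2 → 0 < c → c ≤ EngineV8.klEngC₃3 P R →
      ∀ μ ∈ klWindowC, ∀ U : ℝ, 0 < U → U ≤ EngineV8.klEngU₀4 P R c → ∀ β : ℝ, klBetaMin ≤ β → β ≤ Real.exp (c / U ^ 2) →
      ∀ K : TrigPolyC4v, FrameOK R U (nScales β) μ K → ∀ (L M : ℕ) [NeZero L] [NeZero M],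
      EngineV8.klEngL₃ β U ≤ L → EngineV8.klEngM₃ β U L ≤ M → ∀ n : ℕ, 1 ≤ n → n ≤ nScales β + 1 → ∀ n' : ℕ, n ≤ n' →
      ∀ (k d m₀ m₁ : ℕ) (a b : GrassmannAlgebra ℂ (SpaceTimeIdx L M × SectorLeg (sectorCount n))) (s : Fin d → Fin 2),
        (univ.filter fun i => s i = 0).card = m₀ → (univ.filter fun i => s i = 1).card = m₁ → ∀ p : Fin d, s p = 1 →
        ∀ (z : SpaceTimeIdx L M × SectorLeg (sectorCount n)) (α : ℝ),
        (∀ X, ∑ Y, ‖((sectorSubMatrix L M β (bgmFatMultiplier L M klE0 β (nambuXiCT L μ K) n)).transpose *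
          klSliceCov L M β μ K n' * sectorSubMatrix L M β (bgmFatMultiplier L M klE0 β (nambuXiCT L μ K) n)) X Y‖ ≤ α) →
        (∀ Y, ∑ X, ‖((sectorSubMatrix L M β (bgmFatMultiplier L M klE0 β (nambuXiCT L μ K) n)).transpose *
          klSliceCov L M β μ K n' * sectorSubMatrix L M β (bgmFatMultiplier L M klE0 β (nambuXiCT L μ K) n)) X Y‖ ≤ α) →
        ∀ (Na Nb : ℝ), 0 ≤ Na →
        (∀ (X₀ : SpaceTimeIdx L M × SectorLeg (sectorCount n)) (σ : Fin k → SectorLeg (sectorCount n)),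
          ∑ x : Fin k → SpaceTimeIdx L M, ∑ Z₀ : Fin m₀ → SpaceTimeIdx L M × SectorLeg (sectorCount n),
            ‖kernel ℂ a (k + 1 + m₀) (Fin.append
              (Fin.cons X₀ (fun i => (x i, σ i)) : Fin (k + 1) → SpaceTimeIdx L M × SectorLeg (sectorCount n)) Z₀)‖ ≤ Na) →
        (∀ p₁ : Fin m₁, ∑ Y : Fin (k + 1) → SpaceTimeIdx L M × SectorLeg (sectorCount n),
          ∑ Y₁ ∈ univ.filter (fun Y₁ : Fin m₁ → SpaceTimeIdx L M × SectorLeg (sectorCount n) => Y₁ p₁ = z),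
            ‖kernel ℂ b (k + 1 + m₁) (Fin.append Y Y₁)‖ ≤ Nb) →
        ∑ Z ∈ univ.filter (fun Z : Fin d → SpaceTimeIdx L M × SectorLeg (sectorCount n) => Z p = z),
            ‖kernel ℂ (((grassmannLaplacian ℂ (crossCov ℂ
                ((sectorSubMatrix L M β (bgmFatMultiplier L M klE0 β (nambuXiCT L μ K) n)).transpose * klSliceCov L M β μ K n' *
                  sectorSubMatrix L M β (bgmFatMultiplier L M klE0 β (nambuXiCT L μ K) n)))) ^ (k + 1))
              (dblCopy ℂ 0 a * dblCopy ℂ 1 b)) d (fun i => (Z i, s i))‖ ≤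
          (((k + 1 + m₀).factorial * (k + 1 + m₁).factorial : ℝ) / d.factorial) *
            (α * (36 * (Cκ * (klScale klE0 n / klScale klE0 n') * (klE0 * ((8 : ℝ) ^ n)⁻¹))) ^ k * Na * Nb) := by
  obtain ⟨Cκ, hCκ, h⟩ := gram_entry_klSliceCov_bgmFat_klEng
  refine ⟨Cκ, hCκ, ?_⟩
  intro P R c hP hR2 hc hc3 μ hμ U hU hU0 β hβmin hβc K hK L M _ _ hL3 hM3 n hn hnN n' hnn' k d m₀ m₁ a b s hm₀ hm₁ p hp z α hrow hcol
    Na Nb hNa0 hNa hNb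
  have hent := (h P R c hP hR2 hc hc3 μ hμ U hU hU0 β hβmin hβc K hK L M hL3 hM3 n hn hnN n' hnn').1
  obtain ⟨m, rfl⟩ : ∃ m, n = m + 1 := ⟨n - 1, by omega⟩
  have he : (0 : ℝ) < klE0 := by norm_num [klE0]
  have hδ : 0 ≤ Cκ * (klScale klE0 (m + 1) / klScale klE0 n') * (klE0 * ((8 : ℝ) ^ (m + 1))⁻¹) := by
    have := klth_klScale_pos (m + 1); have := klth_klScale_pos n'; positivity
  obtain ⟨sym, hS⟩ : ∃ sym : FreqMomentum L M × Fin 2 → ℂ, klSliceCov L M β μ K n' = normalCovariance L M sym :=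
    ⟨_, by rw [klSliceCov, hubbardCovSliceCT_zero_seed]⟩
  rw [hS] at hrow hcol hent ⊢
  exact sum_norm_kernel_crossLaplacian_pow_bgmFat_le_of_eq_one klE0 β μ K m sym a b s hm₀ hm₁ p hp z hrow hcol hδ hent hNa0 hNa hNb

end Engine

end Summit.HubbardSuperconductivity.HubbardSuperconductivity.Theorems.KLRegimeWick

end
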